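import Summits.CriticalPhenomena.CardyFormulaZ2.Theses.CardyViaSLE6
import Summits.CriticalPhenomena.CardyFormulaZ2.Theorems.CardySelfRefinementLagHandOffTightness
import Literature.Probability.LatticeModels.MedialInterfaceMeasurability

/-!
# Line `limit-exists` for the piece `InterfaceLimitExists` (child X₁ of crux r2
`ConformalCovarianceOfSubseqLimits`, stmt-CriticalPhenomena-0763, route CardyViaSLE6)

`InterfaceLimitExists`: for every Dobrushin domain `D` there is ONE probability law `μ_D` on
`CurveClass ℂ` to which the exploration interfaces of EVERY admissible ℤ²-discretisation family of
`D` converge weakly as `δ → 0⁺` (existence of the scaling limit, independent of the approximation).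

Skeleton: existence = (limit points exist) + (limit points are unique).  Limit points exist by
Aizenman–Burchard tightness, which is a THEOREM in the tree for every admissible family
(`Cruxes.LagHandOff.HittingTournament.stub_tournamentTransfer_tightness`, route CardySelfRefinement,
+ the bridge `isTightAlongMesh_of_isTightMeasureSet_image` + measurability of the interface map,
proved below from `measurable_of_medialExploration`).  Uniqueness is cut into its two genuinely
different halves:

* `stub_familyIndependence` — along a COMMON mesh sequence two admissible families of the same
  domain have the same subsequential limit (boundary stability: the interface does not feel
  mesh-scale changes of the Dobrushin arcs / marks; RSW half-plane arm estimates; L);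
* `stub_sequenceIndependence` — for ONE admissible family, subsequential limits along two mesh
  sequences coincide (the scale-invariance / uniqueness problem on ℤ²: DKKMO 2020 §1.1,
  Schramm–Smirnov 2011 §1; the live engine is CardySelfRefinement's Russo drift
  `ScaleInvariantLimits` + `LagHandOff`; XL/open).

Composition `InterfaceLimitExists_of`: Prokhorov along the mesh (`IsTightAlongMesh.exists_subseq`)
+ the subsequence principle on the countably generated filter `𝓝[>] 0`
(`Filter.tendsto_of_subseq_tendsto`).  Real proof, no sorry outside the two stubs.
-/

noncomputable section

open Filter Topology MeasureTheory Set
open scoped BoundedContinuousFunction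
open Literature.Probability.RandomPlanarGeometry Literature.Probability.LatticeModels
open Literature.Probability.Percolation (bondPercolation half BondConfig)
open Summit.CriticalPhenomena.CardyFormulaZ2.Theses.CardyViaSLE6

namespace Summit.CriticalPhenomena.CardyFormulaZ2.Cruxes.InterfaceLimitExists.LimitExists

/-- The piece X₁ (verbatim the child statement `InterfaceLimitExists` of the split of
`ConformalCovarianceOfSubseqLimits`; inlined here until the gate writes the route decl). -/
def InterfaceLimitExists : Prop :=
  ∀ D : Literature.Probability.RandomPlanarGeometry.DobrushinDomain, ∃ μ : MeasureTheory.Measure (Literature.Probability.RandomPlanarGeometry.CurveClass ℂ), MeasureTheory.IsProbabilityMeasure μ ∧ ∀ (E : ℝ → Literature.Probability.LatticeModels.DiscreteDobrushin), Literature.Probability.LatticeModels.ZdDiscretisationFamily D E → ∀ f : BoundedContinuousFunction (Literature.Probability.RandomPlanarGeometry.CurveClass ℂ) ℝ, Filter.Tendsto (fun δ => ∫ ω, f (Literature.Probability.Percolation.bondInterfaceIn D (E δ) ω) ∂(Literature.Probability.Percolation.bondPercolation (Literature.Probability.LatticeModels.zdGraph 2) Literature.Probability.Percolation.half)) (nhdsWithin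 0 (Set.Ioi 0)) (nhds (∫ γ, f γ ∂μ))

/-! ### Registered stubs -/

/-- STUB (L) — **family independence along a common mesh sequence.** Two admissible
ℤ²-discretisation families `E, E'` of the same Dobrushin domain, run along the same meshes
`s n → 0⁺`, have the same subsequential interface limit.  Content: the interface law is insensitive
to mesh-scale modifications of the wired / dual-wired arcs and of the discrete marks (RSW half-plane
2- and 3-arm bounds at boundary points; Camia–Newman 2006 §5, Nolin 2008 Thm 23).  Why it might
fail: wild prime ends / fjords of `∂Ω` where the two families' arcs differ at many scales. -/
theorem stub_familyIndependence :
    ∀ (D : DobrushinDomain) (E E' : ℝ → DiscreteDobrushin),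
      ZdDiscretisationFamily D E → ZdDiscretisationFamily D E' →
      ∀ s : ℕ → ℝ, Tendsto s atTop (𝓝[>] (0 : ℝ)) →
      ∀ (μ μ' : Measure (CurveClass ℂ)) [IsProbabilityMeasure μ] [IsProbabilityMeasure μ'],
        (∀ f : CurveClass ℂ →ᵇ ℝ, Tendsto (fun n => ∫ ω, f (Literature.Probability.Percolation.bondInterfaceIn D (E (s n)) ω)
          ∂(bondPercolation (zdGraph 2) half)) atTop (𝓝 (∫ γ, f γ ∂μ))) →
        (∀ f : CurveClass ℂ →ᵇ ℝ, Tendsto (fun n => ∫ ω, f (Literature.Probability.Percolation.bondInterfaceIn D (E' (s n)) ω)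
          ∂(bondPercolation (zdGraph 2) half)) atTop (𝓝 (∫ γ, f γ ∂μ'))) →
        μ = μ' := by
  sorry

/-- STUB (XL, the hard one) — **sequence independence for one family** (scale invariance /
uniqueness of subsequential limits on ℤ²): for one admissible family `E` of `D`, subsequential
interface limits along any two mesh sequences coincide.  Engines: CardySelfRefinement's Russo drift
(`ScaleInvariantLimits`, `LagsToInvariance`, `TwoLagsAllLags`: invariance of quad-crossing limits
under the lags 2 and 3, hence all dilations) transferred to interfaces (`LagHandOff`), or an RG /
coupling argument.  Why it might fail: an RG limit cycle (log-periodic dependence on `log δ`). -/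
theorem stub_sequenceIndependence :
    ∀ (D : DobrushinDomain) (E : ℝ → DiscreteDobrushin), ZdDiscretisationFamily D E →
      ∀ s s' : ℕ → ℝ, Tendsto s atTop (𝓝[>] (0 : ℝ)) → Tendsto s' atTop (𝓝[>] (0 : ℝ)) →
      ∀ (μ μ' : Measure (CurveClass ℂ)) [IsProbabilityMeasure μ] [IsProbabilityMeasure μ'],
        (∀ f : CurveClass ℂ →ᵇ ℝ, Tendsto (fun n => ∫ ω, f (Literature.Probability.Percolation.bondInterfaceIn D (E (s n)) ω)
          ∂(bondPercolation (zdGraph 2) half)) atTop (𝓝 (∫ γ, f γ ∂μ))) →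
        (∀ f : CurveClass ℂ →ᵇ ℝ, Tendsto (fun n => ∫ ω, f (Literature.Probability.Percolation.bondInterfaceIn D (E (s' n)) ω)
          ∂(bondPercolation (zdGraph 2) half)) atTop (𝓝 (∫ γ, f γ ∂μ'))) →
        μ = μ' := by
  sorry

/-! ### Tree inputs (proved): measurability and tightness of the interface for every family -/

/-- The interface map of any discrete Dobrushin data is measurable (a function of the medial
exploration; `measurable_of_medialExploration`). -/
theorem measurable_bondInterfaceIn (D : DobrushinDomain) (E : DiscreteDobrushin) :
    Measurable (Literature.Probability.Percolation.bondInterfaceIn D E) :=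
  measurable_of_medialExploration E fun ω ω' h => by
    simp only [Literature.Probability.Percolation.bondInterfaceIn, medialExplorationCurve_congr h]

/-- Eventual a.e.-measurability along the mesh (in fact for every mesh and every law). -/
theorem eventually_aemeasurable_bondInterfaceIn (D : DobrushinDomain) (E : ℝ → DiscreteDobrushin) :
    ∀ᶠ δ in 𝓝[>] (0 : ℝ),
      AEMeasurable (Literature.Probability.Percolation.bondInterfaceIn D (E δ)) (bondPercolation (zdGraph 2) half) :=
  Eventually.of_forall fun δ => (measurable_bondInterfaceIn D (E δ)).aemeasurable

/-- Aizenman–Burchard tightness along the mesh for EVERY admissible family (tree theorem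
`stub_tournamentTransfer_tightness` of route CardySelfRefinement + the bridge
`isTightAlongMesh_of_isTightMeasureSet_image`).  This is route CardyViaSLE6's support item
`InterfaceTightness`, proved. -/
theorem isTightAlongMesh_bondInterfaceIn (D : DobrushinDomain) (E : ℝ → DiscreteDobrushin)
    (hE : ZdDiscretisationFamily D E) :
    IsTightAlongMesh (Ωδ := fun _ => BondConfig (Site 2)) (fun δ => Literature.Probability.Percolation.bondInterfaceIn D (E δ))
      (fun _ => bondPercolation (zdGraph 2) half) := by
  obtain ⟨δ₀, hδ₀, h⟩ :=
    Summit.CriticalPhenomena.CardyFormulaZ2.Cruxes.LagHandOff.HittingTournament.stub_tournamentTransfer_tightness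
      D E hE
  exact isTightAlongMesh_of_isTightMeasureSet_image (Ωδ := fun _ => BondConfig (Site 2))
    (Y := fun δ => Literature.Probability.Percolation.bondInterfaceIn D (E δ)) (P := fun _ => bondPercolation (zdGraph 2) half)
    (eventually_aemeasurable_bondInterfaceIn D E) hδ₀ h

/-- The support item `InterfaceTightness` of route CardyViaSLE6, by name. -/
theorem interfaceTightness : InterfaceTightness :=
  fun D E hE => isTightAlongMesh_bondInterfaceIn D E hE

/-! ### Composition -/

/-- **Composition (real proof).** Family independence + sequence independence ⇒ the scaling limit
exists: Prokhorov along the mesh gives limit points for every admissible family along every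
sequence; the two stubs identify them all with one reference limit; the subsequence principle on
the countably generated filter `𝓝[>] 0` upgrades this to convergence along the filter. -/
theorem InterfaceLimitExists_of
    (hF : ∀ (D : DobrushinDomain) (E E' : ℝ → DiscreteDobrushin),
      ZdDiscretisationFamily D E → ZdDiscretisationFamily D E' →
      ∀ s : ℕ → ℝ, Tendsto s atTop (𝓝[>] (0 : ℝ)) →
      ∀ (μ μ' : Measure (CurveClass ℂ)) [IsProbabilityMeasure μ] [IsProbabilityMeasure μ'],
        (∀ f : CurveClass ℂ →ᵇ ℝ, Tendsto (fun n => ∫ ω, f (Literature.Probability.Percolation.bondInterfaceIn D (E (s n)) ω)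
          ∂(bondPercolation (zdGraph 2) half)) atTop (𝓝 (∫ γ, f γ ∂μ))) →
        (∀ f : CurveClass ℂ →ᵇ ℝ, Tendsto (fun n => ∫ ω, f (Literature.Probability.Percolation.bondInterfaceIn D (E' (s n)) ω)
          ∂(bondPercolation (zdGraph 2) half)) atTop (𝓝 (∫ γ, f γ ∂μ'))) →
        μ = μ')
    (hS : ∀ (D : DobrushinDomain) (E : ℝ → DiscreteDobrushin), ZdDiscretisationFamily D E →
      ∀ s s' : ℕ → ℝ, Tendsto s atTop (𝓝[>] (0 : ℝ)) → Tendsto s' atTop (𝓝[>] (0 : ℝ)) →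
      ∀ (μ μ' : Measure (CurveClass ℂ)) [IsProbabilityMeasure μ] [IsProbabilityMeasure μ'],
        (∀ f : CurveClass ℂ →ᵇ ℝ, Tendsto (fun n => ∫ ω, f (Literature.Probability.Percolation.bondInterfaceIn D (E (s n)) ω)
          ∂(bondPercolation (zdGraph 2) half)) atTop (𝓝 (∫ γ, f γ ∂μ))) →
        (∀ f : CurveClass ℂ →ᵇ ℝ, Tendsto (fun n => ∫ ω, f (Literature.Probability.Percolation.bondInterfaceIn D (E (s' n)) ω)
          ∂(bondPercolation (zdGraph 2) half)) atTop (𝓝 (∫ γ, f γ ∂μ'))) →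
        μ = μ') :
    InterfaceLimitExists := by
  intro D
  classical
  by_cases hex : ∃ E₀ : ℝ → DiscreteDobrushin, ZdDiscretisationFamily D E₀
  · obtain ⟨E₀, hE₀⟩ := hex
    -- reference limit along the meshes 1/(n+1)
    have hs₀ : Tendsto (fun n : ℕ => 1 / ((n : ℝ) + 1)) atTop (𝓝[>] (0 : ℝ)) :=
      tendsto_nhdsWithin_iff.2 ⟨tendsto_one_div_add_atTop_nhds_zero_nat,
        Eventually.of_forall fun n => Set.mem_Ioi.2 Nat.one_div_pos_of_nat⟩
    obtain ⟨φ, μ, hφ, hμ, hlim₀⟩ := (isTightAlongMesh_bondInterfaceIn D E₀ hE₀).exists_subseq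
      (eventually_aemeasurable_bondInterfaceIn D E₀) hs₀
    refine ⟨μ, hμ, fun E hE f => ?_⟩
    refine tendsto_of_subseq_tendsto fun ns hns => ?_
    -- a limit point of the `E`-interfaces along a subsequence of `ns`
    obtain ⟨ms, ν, hms, hν, hlimν⟩ := (isTightAlongMesh_bondInterfaceIn D E hE).exists_subseq
      (eventually_aemeasurable_bondInterfaceIn D E) hns
    -- a limit point of the `E₀`-interfaces along a further subsequence
    have hns' : Tendsto (ns ∘ ms) atTop (𝓝[>] (0 : ℝ)) := hns.comp hms.tendsto_atTop
    obtain ⟨ms', ν₀, hms', hν₀, hlimν₀⟩ :=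
      (isTightAlongMesh_bondInterfaceIn D E₀ hE₀).exists_subseq
        (eventually_aemeasurable_bondInterfaceIn D E₀) hns'
    haveI := hμ; haveI := hν; haveI := hν₀
    -- sequence independence for `E₀`: the reference limit is `ν₀`
    have h1 : μ = ν₀ := hS D E₀ hE₀ (fun n => 1 / ((φ n : ℝ) + 1)) ((ns ∘ ms) ∘ ms')
      (hs₀.comp hφ.tendsto_atTop) (hns'.comp hms'.tendsto_atTop) μ ν₀ hlim₀ hlimν₀
    -- family independence along the common sequence: `ν₀ = ν`
    have h2 : ν₀ = ν := hF D E₀ E hE₀ hE ((ns ∘ ms) ∘ ms') (hns'.comp hms'.tendsto_atTop) ν₀ ν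
      hlimν₀ (fun g => (hlimν g).comp hms'.tendsto_atTop)
    refine ⟨ms, ?_⟩
    have h := hlimν f
    rw [← h2, ← h1] at h
    exact h
  · refine ⟨Measure.dirac (CurveClass.mk (Curve.const 0)), inferInstance, fun E hE => ?_⟩
    exact (hex ⟨E, hE⟩).elim

/-- The piece, from the registered stubs. -/
theorem interfaceLimitExists : InterfaceLimitExists :=
  InterfaceLimitExists_of stub_familyIndependence stub_sequenceIndependence

end Summit.CriticalPhenomena.CardyFormulaZ2.Cruxes.InterfaceLimitExists.LimitExists
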